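import Mathlib.Analysis.SpecialFunctions.Log.Deriv
import Mathlib.Analysis.Complex.ExponentialBounds
import HarnessLib

/-!
# Harmonic-sum and logarithm inequalities for the upper bound `M_{k,ε} ≤ (k/(k-1)) log(2k-1)`

Topic `Literature/NumberTheory/Sieve`; third support file (pure real analysis, Mathlib only) of the
discharge of `Literature.Barriers.Parity.Polymath2014_epsFunctional_le` (Polymath 8b, Proposition 6.5).
The two regimes of `PolymathMkEpsWeights.lean` bound `M_{k,ε}` by
`T_A = (k/(k-1)) log k + ε + ∑_{j=1}^{k-1} (min(2ε,(1-ε)/j) - ε)₊` and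
`T_B ≤ 2ε + (1-ε)((k/(k-1)) log k + H_{k-1})`; this file supplies the elementary inequalities turning
these into `(k/(k-1)) log(2k-1)`:

* `MkEps.two_mul_le_log_sub_log` — `2x ≤ log(1+x) - log(1-x)` (`0 ≤ x < 1`), from the power series
  `Real.hasSum_log_sub_log_of_abs_lt_one`; hence `1/n ≤ log(2n+1) - log(2n-1)` and the sharp harmonic
  bounds `∑_{p ≤ i < q} 1/(i+1) ≤ log(2q+1) - log(2p+1)` (`MkEps.sum_Ico_inv_le_log`), `H_n ≤ log(2n+1)`.
* `MkEps.eps_add_sum_le` — `ε + ∑_{j=1}^{K} (min(2ε,(1-ε)/j) - ε)₊ ≤ max(log 2, ε)` for all `K` and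
  `0 ≤ ε < 1` (the regime-A budget never exceeds `log 2`): with `p = ⌊(1-ε)/(2ε)⌋` the sum is at most
  `(1-ε)(H_{2p} - H_p)` (+`ε`) or `(1-ε)(H_{2p+1} - H_p)`, and the two harmonic bounds above close it.
(The regime-switch numerics `2(n+1) + n H_n ≤ (2(n+1)²/n) log(n+1)` live in `PolymathMkEpsUpperBound.lean`.)

All statements are [folklore] calculus; nothing here is specific to sieves.

## References
* [Polymath8b2014] D. H. J. Polymath, *Variants of the Selberg sieve, and bounded intervals containing many
  primes*, Res. Math. Sci. 1 (2014), Art. 12 = arXiv:1407.4897, Proposition 6.5.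
-/

noncomputable section

open Finset
open scoped BigOperators

namespace Literature.NumberTheory.Sieve

namespace MkEps

/-! ### `2x ≤ log((1+x)/(1-x))` and sharp harmonic bounds -/

/-- `2x ≤ log(1+x) - log(1-x)` for `0 ≤ x < 1` (first term of the series
`log((1+x)/(1-x)) = 2 ∑ x^{2k+1}/(2k+1)`, all of whose terms are nonnegative). [folklore] -/
theorem two_mul_le_log_sub_log {x : ℝ} (hx0 : 0 ≤ x) (hx1 : x < 1) :
    2 * x ≤ Real.log (1 + x) - Real.log (1 - x) := by
  have h := Real.hasSum_log_sub_log_of_abs_lt_one (show |x| < 1 by rwa [abs_of_nonneg hx0])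
  have := sum_le_hasSum {0} (fun k _ => by positivity) h
  simpa using this

/-- `1/n ≤ log(2n+1) - log(2n-1)` for `n ≥ 1` (`x = 1/(2n)` in `two_mul_le_log_sub_log`). [folklore] -/
theorem inv_le_log_sub_log {n : ℕ} (hn : 1 ≤ n) :
    1 / (n : ℝ) ≤ Real.log (2 * n + 1) - Real.log (2 * n - 1) := by
  have hn' : (1 : ℝ) ≤ n := by exact_mod_cast hn
  have h := two_mul_le_log_sub_log (x := 1 / (2 * n)) (by positivity)
    (by rw [div_lt_one (by positivity)]; linarith)
  have e1 : (1 : ℝ) + 1 / (2 * n) = (2 * n + 1) / (2 * n) := by field_simp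
  have e2 : (1 : ℝ) - 1 / (2 * n) = (2 * n - 1) / (2 * n) := by field_simp
  rw [e1, e2, Real.log_div (by positivity) (by positivity),
    Real.log_div (by linarith) (by positivity)] at h
  have e3 : (2 : ℝ) * (1 / (2 * n)) = 1 / n := by field_simp
  linarith

/-- **Sharp harmonic block bound**: `∑_{p ≤ i < q} 1/(i+1) ≤ log(2q+1) - log(2p+1)` (midpoint convexity,
telescoped from `inv_le_log_sub_log`). [folklore] -/
theorem sum_Ico_inv_le_log {p q : ℕ} (hpq : p ≤ q) :
    ∑ i ∈ Finset.Ico p q, 1 / ((i : ℝ) + 1) ≤ Real.log (2 * q + 1) - Real.log (2 * p + 1) := by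
  induction q, hpq using Nat.le_induction with
  | base => simp
  | succ q hpq ih =>
    rw [Finset.sum_Ico_succ_top hpq]
    have h := inv_le_log_sub_log (n := q + 1) (by omega)
    push_cast at h ⊢
    have e : (2 : ℝ) * (q + 1) - 1 = 2 * q + 1 := by ring
    rw [e] at h
    have e2 : (2 : ℝ) * (q + 1) + 1 = 2 * (q + 1) + 1 := by ring
    linarith

/-- `H_n ≤ log(2n+1)` (`p = 0` in `sum_Ico_inv_le_log`). [folklore] -/
theorem harmonic_le_log (n : ℕ) :
    ∑ i ∈ Finset.range n, 1 / ((i : ℝ) + 1) ≤ Real.log (2 * n + 1) := by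
  have h := sum_Ico_inv_le_log (Nat.zero_le n)
  rw [Finset.range_eq_Ico]
  simpa using h

/-! ### The regime-A budget never exceeds `log 2` -/

/-- Termwise facts for `f_i = (min(2ε, c/(i+1)) - ε)₊`: `f_i ≤ ε`, and (`term_eq_zero`) `f_i = 0` once
`c/(i+1) ≤ ε`. [folklore] -/
theorem term_le_eps {ε c : ℝ} (hε : 0 ≤ ε) (i : ℕ) :
    max 0 (min (2 * ε) (c / ((i : ℝ) + 1)) - ε) ≤ ε :=
  max_le hε (by linarith [min_le_left (2 * ε) (c / ((i : ℝ) + 1))])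

/-- See `term_le_eps`. [folklore] -/
theorem term_eq_zero {ε c : ℝ} (i : ℕ) (h : c / ((i : ℝ) + 1) ≤ ε) :
    max 0 (min (2 * ε) (c / ((i : ℝ) + 1)) - ε) = 0 :=
  max_eq_left (by linarith [min_le_right (2 * ε) (c / ((i : ℝ) + 1))])

/-- Truncation: if the terms vanish from index `N` on, the sum over `range K` is at most the sum over
`range N`. [folklore] -/
theorem sum_range_le_sum_range_of_vanish {f : ℕ → ℝ} (hf : ∀ i, 0 ≤ f i) {N : ℕ}
    (hN : ∀ i, N ≤ i → f i = 0) (K : ℕ) :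
    ∑ i ∈ Finset.range K, f i ≤ ∑ i ∈ Finset.range N, f i := by
  classical
  rw [← Finset.sum_filter_add_sum_filter_not (Finset.range K) (fun i => i < N)]
  have h2 : ∑ i ∈ (Finset.range K).filter (fun i => ¬ i < N), f i = 0 :=
    Finset.sum_eq_zero fun i hi => hN i (not_lt.1 (Finset.mem_filter.1 hi).2)
  rw [h2, add_zero]
  exact Finset.sum_le_sum_of_subset_of_nonneg
    (fun i hi => Finset.mem_range.2 (Finset.mem_filter.1 hi).2) fun i _ _ => hf i

/-- The block estimate behind `eps_add_sum_le`: for `0 < ε`, `c = 1 - ε` and a cut `N` with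
`N ε ≤ c ≤ (N+1) ε` (so the terms vanish from index `N` on and are `c/(i+1) - ε ≥ 0` before),
`∑_{i<K} f_i ≤ p ε + ∑_{p ≤ i < N} (c/(i+1) - ε)` for every `p ≤ N`. [folklore] -/
theorem sum_terms_le_block {ε : ℝ} (hε : 0 < ε) {p N : ℕ} (hpN : p ≤ N)
    (hblock : (N : ℝ) * ε ≤ 1 - ε) (hcut : (1 - ε) ≤ ((N : ℝ) + 1) * ε) (K : ℕ) :
    ∑ i ∈ Finset.range K, max 0 (min (2 * ε) ((1 - ε) / ((i : ℝ) + 1)) - ε) ≤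
      p * ε + ∑ i ∈ Finset.Ico p N, ((1 - ε) / ((i : ℝ) + 1) - ε) := by
  set f : ℕ → ℝ := fun i => max 0 (min (2 * ε) ((1 - ε) / ((i : ℝ) + 1)) - ε) with hf
  have hf0 : ∀ i, 0 ≤ f i := fun i => le_max_left _ _
  have hvan : ∀ i, N ≤ i → f i = 0 := by
    intro i hi
    apply term_eq_zero
    rw [div_le_iff₀ (by positivity)]
    have : ((N : ℝ) + 1) ≤ (i : ℝ) + 1 := by exact_mod_cast Nat.succ_le_succ hi
    nlinarith
  refine (sum_range_le_sum_range_of_vanish hf0 hvan K).trans ?_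
  rw [Finset.range_eq_Ico, ← Finset.sum_Ico_consecutive _ (Nat.zero_le p) hpN]
  refine add_le_add ?_ (Finset.sum_le_sum fun i hi => ?_)
  · calc ∑ i ∈ Finset.Ico 0 p, f i ≤ ∑ i ∈ Finset.Ico 0 p, ε :=
          Finset.sum_le_sum fun i _ => term_le_eps hε.le i
      _ = p * ε := by simp
  · have hiN : i < N := (Finset.mem_Ico.1 hi).2
    have hle : ε ≤ (1 - ε) / ((i : ℝ) + 1) := by
      rw [le_div_iff₀ (by positivity)]
      have : (i : ℝ) + 1 ≤ N := by exact_mod_cast hiN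
      nlinarith
    have hmin : 0 ≤ min (2 * ε) ((1 - ε) / ((i : ℝ) + 1)) - ε := by
      rw [sub_nonneg, le_min_iff]; exact ⟨by linarith, hle⟩
    change max 0 (min (2 * ε) ((1 - ε) / ((i : ℝ) + 1)) - ε) ≤ _
    rw [max_eq_right hmin]
    linarith [min_le_right (2 * ε) ((1 - ε) / ((i : ℝ) + 1))]

/-- `∑_{p ≤ i < N} (c/(i+1) - ε) = c · ∑_{p ≤ i < N} 1/(i+1) - (N - p) ε`. [folklore] -/
theorem sum_Ico_div_sub (c ε : ℝ) {p N : ℕ} (hpN : p ≤ N) :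
    ∑ i ∈ Finset.Ico p N, (c / ((i : ℝ) + 1) - ε) =
      c * ∑ i ∈ Finset.Ico p N, 1 / ((i : ℝ) + 1) - ((N : ℝ) - p) * ε := by
  rw [Finset.sum_sub_distrib, Finset.sum_const, Nat.card_Ico, nsmul_eq_mul, Nat.cast_sub hpN,
    Finset.mul_sum]
  congr 1
  exact Finset.sum_congr rfl fun i _ => by ring

/-- `log(4p+1) - log(2p+1) ≤ log 2 - 1/(4p+2)` (from `1 - 1/x ≤ log x` at `x = (4p+2)/(4p+1)`). [folklore] -/
theorem log_block_even_le (p : ℕ) :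
    Real.log (4 * p + 1) - Real.log (2 * p + 1) ≤ Real.log 2 - 1 / (4 * p + 2) := by
  have hp : (0 : ℝ) ≤ p := Nat.cast_nonneg p
  have h := Real.one_sub_inv_le_log_of_pos (x := (4 * p + 2) / (4 * p + 1)) (by positivity)
  rw [inv_div, Real.log_div (by positivity) (by positivity)] at h
  have e : (4 : ℝ) * p + 2 = 2 * (2 * p + 1) := by ring
  rw [e, Real.log_mul (by norm_num) (by positivity)] at h
  have e2 : (1 : ℝ) - (4 * p + 1) / (2 * (2 * p + 1)) = 1 / (4 * p + 2) := by
    field_simp; ring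
  rw [e2] at h
  linarith

/-- `log(4p+3) - log(2p+1) ≤ log 2 + 1/(4p+2)` (from `log x ≤ x - 1` at `x = (4p+3)/(4p+2)`). [folklore] -/
theorem log_block_odd_le (p : ℕ) :
    Real.log (4 * p + 3) - Real.log (2 * p + 1) ≤ Real.log 2 + 1 / (4 * p + 2) := by
  have hp : (0 : ℝ) ≤ p := Nat.cast_nonneg p
  have h := Real.log_le_sub_one_of_pos (x := (4 * p + 3) / (4 * p + 2)) (by positivity)
  rw [Real.log_div (by positivity) (by positivity)] at h
  have e : (4 : ℝ) * p + 2 = 2 * (2 * p + 1) := by ring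
  rw [e, Real.log_mul (by norm_num) (by positivity)] at h
  have e2 : ((4 : ℝ) * p + 3) / (2 * (2 * p + 1)) - 1 = 1 / (4 * p + 2) := by
    field_simp; ring
  rw [e2] at h
  linarith

/-- **The regime-A budget never exceeds `log 2`.**  For `0 ≤ ε < 1` and every `K`,
`ε + ∑_{i<K} (min(2ε, (1-ε)/(i+1)) - ε)₊ ≤ max(log 2, ε)`.  For `ε ≥ 1/3` only the term `i = 0` survives and
the left side is `max(ε, 1-ε)`; for `0 < ε < 1/3`, with `p = ⌊(1-ε)/(2ε)⌋ ≥ 1`, the sum is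
`≤ (1-ε)(H_{2p} - H_p)` when `(2p+1)ε ≥ 1-ε` and the whole is `≤ (1-ε)(H_{2p+1} - H_p)` otherwise, and the
sharp harmonic bounds `sum_Ico_inv_le_log` reduce the claim to `1/(2p+1) ≤ 2 log 2 - 1`, resp.
`(p+1)/(2p+1) ≤ log 2`. [folklore] -/
theorem eps_add_sum_le {ε : ℝ} (hε0 : 0 ≤ ε) (hε1 : ε < 1) (K : ℕ) :
    ε + ∑ i ∈ Finset.range K, max 0 (min (2 * ε) ((1 - ε) / ((i : ℝ) + 1)) - ε) ≤
      max (Real.log 2) ε := by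
  have hlog2 : (0.6931471803 : ℝ) < Real.log 2 := Real.log_two_gt_d9
  set f : ℕ → ℝ := fun i => max 0 (min (2 * ε) ((1 - ε) / ((i : ℝ) + 1)) - ε) with hf
  have hf0 : ∀ i, 0 ≤ f i := fun i => le_max_left _ _
  rcases hε0.eq_or_lt with h0 | hε
  · -- ε = 0
    have hz : ∀ i, f i = 0 := fun i => by
      rw [hf]; dsimp only; rw [← h0]
      exact max_eq_left (by have := min_le_left (2 * (0:ℝ)) ((1 - 0) / ((i : ℝ) + 1)); linarith)
    rw [Finset.sum_eq_zero fun i _ => hz i, add_zero]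
    exact le_max_right _ _
  rcases le_or_gt (1 / 3) ε with h3 | h3
  · -- ε ≥ 1/3: only `i = 0` survives
    have hvan : ∀ i, 1 ≤ i → f i = 0 := by
      intro i hi
      apply term_eq_zero
      rw [div_le_iff₀ (by positivity)]
      have : (2 : ℝ) ≤ (i : ℝ) + 1 := by
        have : (1 : ℝ) ≤ i := by exact_mod_cast hi
        linarith
      nlinarith
    have h1 : ∑ i ∈ Finset.range K, f i ≤ f 0 := by
      refine (sum_range_le_sum_range_of_vanish hf0 hvan K).trans ?_
      simp
    have h2 : f 0 ≤ max 0 (1 - 2 * ε) := by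
      rw [hf]; dsimp only
      refine max_le_max le_rfl ?_
      have := min_le_right (2 * ε) ((1 - ε) / (((0 : ℕ) : ℝ) + 1))
      have e0 : (((0 : ℕ) : ℝ) + 1) = 1 := by norm_num
      rw [e0, div_one] at this ⊢
      linarith
    rcases le_or_gt (1 - 2 * ε) 0 with h4 | h4
    · rw [max_eq_left h4] at h2
      calc ε + ∑ i ∈ Finset.range K, f i ≤ ε := by linarith
        _ ≤ max (Real.log 2) ε := le_max_right _ _
    · rw [max_eq_right h4.le] at h2
      calc ε + ∑ i ∈ Finset.range K, f i ≤ 1 - ε := by linarith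
        _ ≤ Real.log 2 := by linarith
        _ ≤ max (Real.log 2) ε := le_max_left _ _
  · -- 0 < ε < 1/3
    have ha1 : (1 : ℝ) ≤ (1 - ε) / (2 * ε) := by rw [le_div_iff₀ (by positivity)]; linarith
    set p : ℕ := ⌊(1 - ε) / (2 * ε)⌋₊ with hpdef
    have hp1 : 1 ≤ p := Nat.le_floor (by exact_mod_cast ha1)
    have hpR : (1 : ℝ) ≤ p := by exact_mod_cast hp1
    have hpl : (p : ℝ) ≤ (1 - ε) / (2 * ε) := Nat.floor_le (by positivity)
    have hpu : (1 - ε) / (2 * ε) < p + 1 := Nat.lt_floor_add_one _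
    rw [le_div_iff₀ (by positivity)] at hpl
    rw [div_lt_iff₀ (by positivity)] at hpu
    refine le_trans ?_ (le_max_left _ _)
    rcases le_or_gt (1 - ε) ((2 * p + 1) * ε) with hi | hii
    · -- sub-case (i): cut at N = 2p
      have hsum := sum_terms_le_block hε (p := p) (N := 2 * p) (by omega)
        (by push_cast; linarith) (by push_cast; linarith) K
      rw [sum_Ico_div_sub _ _ (by omega : p ≤ 2 * p)] at hsum
      have hH := sum_Ico_inv_le_log (show p ≤ 2 * p by omega)
      have hblk := log_block_even_le p
      push_cast at hsum hH
      have e4 : (2 : ℝ) * (2 * p) + 1 = 4 * p + 1 := by ring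
      rw [e4] at hH
      have hεp : ε * (2 * p + 1) ≤ 1 := by linarith
      have hc0 : 0 ≤ 1 - ε := by linarith
      -- ε + (1-ε) r ≤ log 2 with r ≤ log 2 - 1/(4p+2), ε ≤ 1/(2p+1)
      have hS0 : 0 ≤ ∑ i ∈ Finset.Ico p (2 * p), 1 / ((i : ℝ) + 1) :=
        Finset.sum_nonneg fun i _ => by positivity
      have step : ε + ∑ i ∈ Finset.range K, f i ≤
          ε + (1 - ε) * (Real.log 2 - 1 / (4 * p + 2)) := by
        have := mul_le_mul_of_nonneg_left (hH.trans hblk) hc0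
        change ε + ∑ i ∈ Finset.range K, f i ≤ _
        linarith
      refine step.trans ?_
      have hq : 0 < (4 : ℝ) * p + 2 := by positivity
      have key : ε * (1 - Real.log 2 + 1 / (4 * p + 2)) ≤ 1 / (4 * p + 2) := by
        rw [show (4 : ℝ) * p + 2 = 2 * (2 * p + 1) by ring] at hq ⊢
        have h2p : 0 < (2 : ℝ) * p + 1 := by positivity
        rw [← sub_nonneg]
        have e5 : 1 / (2 * (2 * (p : ℝ) + 1)) - ε * (1 - Real.log 2 + 1 / (2 * (2 * p + 1))) =
            ((1 - ε) - ε * (2 * (2 * p + 1)) * (1 - Real.log 2)) / (2 * (2 * p + 1)) := by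
          field_simp; ring
        rw [e5]
        refine div_nonneg ?_ (by positivity)
        -- (1 - ε) ≥ 2p ε and ε(2(2p+1))(1 - log 2) ≤ ... : use ε(2p+1) ≤ 1
        nlinarith
      nlinarith
    · -- sub-case (ii): cut at N = 2p+1
      have hsum := sum_terms_le_block hε (p := p) (N := 2 * p + 1) (by omega)
        (by push_cast; linarith) (by push_cast; linarith) K
      rw [sum_Ico_div_sub _ _ (by omega : p ≤ 2 * p + 1)] at hsum
      have hH := sum_Ico_inv_le_log (show p ≤ 2 * p + 1 by omega)
      have hblk := log_block_odd_le p
      push_cast at hsum hH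
      have e4 : (2 : ℝ) * (2 * p + 1) + 1 = 4 * p + 3 := by ring
      rw [e4] at hH
      have hc0 : 0 ≤ 1 - ε := by linarith
      have hcu : 1 - ε ≤ (2 * p + 2) / (2 * p + 3) := by
        rw [le_div_iff₀ (by positivity)]; nlinarith
      have step : ε + ∑ i ∈ Finset.range K, f i ≤ (1 - ε) * (Real.log 2 + 1 / (4 * p + 2)) := by
        have := mul_le_mul_of_nonneg_left (hH.trans hblk) hc0
        change ε + ∑ i ∈ Finset.range K, f i ≤ _
        linarith
      refine step.trans ?_
      have hpos : 0 ≤ Real.log 2 + 1 / (4 * p + 2) := by positivity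
      refine (mul_le_mul_of_nonneg_right hcu hpos).trans ?_
      rw [div_mul_eq_mul_div, div_le_iff₀ (by positivity)]
      have e6 : ((2 : ℝ) * p + 2) * (Real.log 2 + 1 / (4 * p + 2)) =
          (2 * p + 2) * Real.log 2 + (p + 1) / (2 * p + 1) := by
        field_simp; ring
      rw [e6]
      have h7 : ((p : ℝ) + 1) / (2 * p + 1) ≤ 2 / 3 := by
        rw [div_le_div_iff₀ (by positivity) (by norm_num)]; linarith
      nlinarith

end MkEps

end Literature.NumberTheory.Sieve
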